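import Literature.MathematicalPhysics.QuantumLattice.OverlapLocality
import Literature.MathematicalPhysics.QuantumLattice.GrassmannIntegralWilsonProofs
import Literature.MathematicalPhysics.QuantumLattice.GaugeGroups
import Literature.MathematicalPhysics.QuantumFieldTheory.QCD
import Mathlib.LinearAlgebra.Matrix.Charpoly.Basic
import HarnessLib

/-!
# Colour-diagonal `SU(3)` link fields: block decomposition of `Γ₅ D_W` and norm-admissibility
# (helpers `flux_negCount_colourDiagonal`, `flux_normAdmissible_of_diagonal` of stub S11)

Helpers of the residual stub S11 `stub_periodicIndexCarrier` of line `free-volume-heavy-witness`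
(reshape r4) of crux `Summit.QuantumFields.QCD.Theses.SpectralDefectExtinction.WindowExtinction`
(item stmt-QuantumFields-8964), lead c3 wave 2.

For an `SU(3)` link field `U` on the periodic four-torus whose every link matrix is the diagonal
matrix of three `U(1)` link fields `V 0, V 1, V 2` (`U e = diag (V 0 e, V 1 e, V 2 e)`):

* `flux_wilsonDirac_apply_colourDiagonal` — every entry of the Wilson–Dirac operator
  `D_W^{SU(3)}(U, m, 1)` between colours `a, b` vanishes for `a ≠ b` and equals the corresponding
  entry of the `U(1)` operator `D_W^{U(1)}(V a, m, 1)` for `a = b` (the colour matrices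
  `ρ(U e)_{ab}`, `ρ(U e⁻¹)_{ab} = conj ρ(U e)_{ba}` are diagonal with entries `V a e`, `(V a e)⁻¹`);
* `flux_reindex_hermitianWilsonDirac_eq_blockDiagonal` — hence, after the re-indexing
  `(x, a, α) ↦ ((x, 0, α), a)`, the Hermitian operator `Γ₅ D_W^{SU(3)}(U, m, 1)` is the block-diagonal
  matrix of the three `Γ₅ D_W^{U(1)}(V a, m, 1)`;
* `flux_charpoly_blockDiagonal` — the characteristic polynomial of a block-diagonal matrix is the
  product of those of the blocks; so (`flux_negCount_colourDiagonal`) the number of characteristic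
  roots with negative real part of `Γ₅ D_W^{SU(3)}(U, m, 1)` is the sum over the three colours of
  those of `Γ₅ D_W^{U(1)}(V a, m, 1)`;
* `flux_normAdmissible_of_diagonal` — the `SU(3)` plaquette matrix is the diagonal matrix of the
  three `U(1)` plaquette phases, so `‖1 − U(p)‖` (the `ℓ²` operator norm of a diagonal matrix is the
  sup of its entries) is `≤ ε` as soon as every `|1 − V a (p)| ≤ ε`.
-/

noncomputable section

namespace Summit.QuantumFields.QCD.Cruxes.WindowExtinction.FreeVolumeHeavyWitness

open Matrix
open Literature.MathematicalPhysics.QuantumLattice Literature.MathematicalPhysics.QuantumFieldTheory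
  Literature.Probability.LatticeModels
open scoped BigOperators Matrix.Norms.L2Operator

/-! ## Block-diagonal matrices -/

/-- The characteristic matrix of a block-diagonal matrix is the block-diagonal matrix of the
characteristic matrices of the blocks. -/
theorem flux_charmatrix_blockDiagonal {o n R : Type*} [Fintype o] [DecidableEq o] [Fintype n]
    [DecidableEq n] [CommRing R] (M : o → Matrix n n R) :
    (blockDiagonal M).charmatrix = blockDiagonal fun k => (M k).charmatrix := by
  ext ⟨i, k⟩ ⟨j, k'⟩
  simp only [charmatrix_apply, blockDiagonal_apply, diagonal_apply, Prod.mk.injEq]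
  by_cases hk : k = k'
  · subst hk
    by_cases hij : i = j
    · subst hij; simp
    · simp [hij]
  · simp [hk]

/-- The characteristic polynomial of a block-diagonal matrix is the product of the characteristic
polynomials of its blocks. -/
theorem flux_charpoly_blockDiagonal {o n R : Type*} [Fintype o] [DecidableEq o] [Fintype n]
    [DecidableEq n] [CommRing R] (M : o → Matrix n n R) :
    (blockDiagonal M).charpoly = ∏ k, (M k).charpoly := by
  unfold Matrix.charpoly
  rw [flux_charmatrix_blockDiagonal, det_blockDiagonal]

/-! ## Entries of a colour-diagonal `SU(3)` link field -/

variable {L : ℕ}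

/-- Entries of a colour-diagonal link matrix in the fundamental representation:
`ρ(U e)_{ab} = δ_{ab} V a e`. -/
theorem flux_rep_apply {U : GaugeConfig 4 L SU3} {V : Fin 3 → GaugeConfig 4 L Circle}
    (hU : ∀ e : Edge 4 L,
      ((U e : SU3) : Matrix (Fin 3) (Fin 3) ℂ) = Matrix.diagonal fun a => ((V a e : Circle) : ℂ))
    (e : Edge 4 L) (a b : Fin 3) :
    fundamentalRep (Fin 3) (U e) a b = if a = b then ((V a e : Circle) : ℂ) else 0 := by
  rw [fundamentalRep_apply, hU e, diagonal_apply]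

/-- Entries of the inverse of a colour-diagonal link matrix in the fundamental representation:
`ρ((U e)⁻¹)_{ab} = δ_{ab} (V a e)⁻¹`. -/
theorem flux_rep_inv_apply {U : GaugeConfig 4 L SU3} {V : Fin 3 → GaugeConfig 4 L Circle}
    (hU : ∀ e : Edge 4 L,
      ((U e : SU3) : Matrix (Fin 3) (Fin 3) ℂ) = Matrix.diagonal fun a => ((V a e : Circle) : ℂ))
    (e : Edge 4 L) (a b : Fin 3) :
    fundamentalRep (Fin 3) (U e)⁻¹ a b = if a = b then (((V a e)⁻¹ : Circle) : ℂ) else 0 := by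
  -- the inverse in `SU(3)` is the adjoint matrix (definitionally)
  have hinv : (((U e)⁻¹ : SU3) : Matrix (Fin 3) (Fin 3) ℂ) = star ((U e : SU3) : Matrix (Fin 3) (Fin 3) ℂ) :=
    rfl
  rw [fundamentalRep_apply, hinv, hU e, star_eq_conjTranspose, diagonal_conjTranspose,
    diagonal_apply]
  split_ifs
  · rw [Pi.star_apply, Circle.coe_inv_eq_conj]; rfl
  · rfl

/-- Entries of the defining representation of `U(1)`: `u1Rep z i j = z` (`i = j = 0`). -/
theorem flux_u1Rep_apply (z : Circle) (i j : Fin 1) : u1Rep z i j = (z : ℂ) := by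
  obtain rfl : i = j := Subsingleton.elim i j
  rw [u1Rep_apply, scalar_apply, diagonal_apply_eq]

/-! ## The colour blocks of the Wilson–Dirac operator -/

/-- **Colour blocks of `D_W` for a colour-diagonal field.**  If every `SU(3)` link matrix is
`diag (V 0 e, V 1 e, V 2 e)`, then the entry of `D_W^{SU(3)}(U, m, 1)` between `(x, a, α)` and
`(y, b, β)` is `0` for `a ≠ b` and is the entry of `D_W^{U(1)}(V a, m, 1)` between `(x, ·, α)` and
`(y, ·, β)` for `a = b`. -/
theorem flux_wilsonDirac_apply_colourDiagonal [NeZero L] {U : GaugeConfig 4 L SU3}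
    {V : Fin 3 → GaugeConfig 4 L Circle}
    (hU : ∀ e : Edge 4 L,
      ((U e : SU3) : Matrix (Fin 3) (Fin 3) ℂ) = Matrix.diagonal fun a => ((V a e : Circle) : ℂ))
    (m : ℝ) (x y : TorusSite 4 L) (a b : Fin 3) (α β : Fin 4) (i j : Fin 1) :
    wilsonDirac (fundamentalRep (Fin 3)) U m 1 (x, a, α) (y, b, β) =
      if a = b then wilsonDirac u1Rep (V a) m 1 (x, i, α) (y, j, β) else 0 := by
  obtain rfl : i = 0 := Subsingleton.elim i 0
  obtain rfl : j = 0 := Subsingleton.elim j 0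
  by_cases hab : a = b
  · subst hab
    rw [if_pos rfl]
    simp only [wilsonDirac, of_apply, flux_rep_apply hU, flux_rep_inv_apply hU, if_true,
      flux_u1Rep_apply, Prod.mk.injEq, true_and]
  · rw [if_neg hab]
    simp only [wilsonDirac, of_apply, flux_rep_apply hU, flux_rep_inv_apply hU, mul_zero,
      ite_self, add_zero, Finset.sum_const_zero, sub_zero, Prod.mk.injEq, hab, false_and,
      and_false, if_false]

/-- **`Γ₅ D_W` of a colour-diagonal field is block-diagonal in colour.**  For any re-indexing
`e : (x, a, α) ↦ ((x, 0, α), a)` of the fermion index `site × colour × spin` of `SU(3)` onto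
`(site × Fin 1 × spin) × colour`, the re-indexed Hermitian Wilson–Dirac operator
`Γ₅ D_W^{SU(3)}(U, m, 1)` is `blockDiagonal (a ↦ Γ₅ D_W^{U(1)}(V a, m, 1))`. -/
theorem flux_reindex_hermitianWilsonDirac_eq_blockDiagonal [NeZero L] {U : GaugeConfig 4 L SU3}
    {V : Fin 3 → GaugeConfig 4 L Circle}
    (hU : ∀ e : Edge 4 L,
      ((U e : SU3) : Matrix (Fin 3) (Fin 3) ℂ) = Matrix.diagonal fun a => ((V a e : Circle) : ℂ))
    (m : ℝ)
    (e : TorusSite 4 L × Fin 3 × Fin 4 ≃ (TorusSite 4 L × Fin 1 × Fin 4) × Fin 3)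
    (he : ∀ q, e.symm q = (q.1.1, q.2, q.1.2.2)) :
    reindex e e (spinorLift gammaFive * wilsonDirac (fundamentalRep (Fin 3)) U m 1) =
      blockDiagonal fun a => spinorLift gammaFive * wilsonDirac u1Rep (V a) m 1 := by
  ext ⟨⟨x, i, α⟩, a⟩ ⟨⟨y, j, β⟩, b⟩
  rw [reindex_apply, submatrix_apply, he, he, blockDiagonal_apply]
  simp only [spinorLift_gammaFive_eq_diagonal, diagonal_mul]
  rw [flux_wilsonDirac_apply_colourDiagonal hU m x y a b α β i j]
  split_ifs with hab
  · subst hab; rfl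
  · rw [mul_zero]

/-! ## The two helpers -/

/-- **Helper `flux_negCount_colourDiagonal` (S11).**  For a colour-diagonal `SU(3)` link field
`U = diag (V 0, V 1, V 2)` on the periodic four-torus and every bare mass `m`, the number of
characteristic roots with negative real part (= negative eigenvalues) of the Hermitian Wilson–Dirac
operator `Γ₅ D_W^{SU(3)}(U, m, 1)` is the sum over the three colours `a` of the same count for the
`U(1)` operators `Γ₅ D_W^{U(1)}(V a, m, 1)`.  Proof: re-index to the block-diagonal form
(`flux_reindex_hermitianWilsonDirac_eq_blockDiagonal`, `Matrix.charpoly_reindex`), whose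
characteristic polynomial is the product of the blocks' (`flux_charpoly_blockDiagonal`); roots of a
product of monic polynomials add (`Polynomial.roots_mul`) and so do the counts
(`Multiset.countP_add`). -/
theorem flux_negCount_colourDiagonal :
    ∀ (L : ℕ) [NeZero L] (U : GaugeConfig 4 L SU3) (V : Fin 3 → GaugeConfig 4 L Circle),
      (∀ e : Edge 4 L, ((U e : SU3) : Matrix (Fin 3) (Fin 3) ℂ) = Matrix.diagonal fun a => ((V a e : Circle) : ℂ)) →
      ∀ m : ℝ,
        (spinorLift gammaFive * wilsonDirac (fundamentalRep (Fin 3)) U m 1).charpoly.roots.countP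
            (fun z : ℂ => z.re < 0) =
          ∑ a : Fin 3, (spinorLift gammaFive * wilsonDirac u1Rep (V a) m 1).charpoly.roots.countP
            (fun z : ℂ => z.re < 0) := by
  intro L _ U V hU m
  set e : TorusSite 4 L × Fin 3 × Fin 4 ≃ (TorusSite 4 L × Fin 1 × Fin 4) × Fin 3 :=
    { toFun := fun p => ((p.1, 0, p.2.2), p.2.1)
      invFun := fun q => (q.1.1, q.2, q.1.2.2)
      left_inv := fun _ => rfl
      right_inv := fun q => by
        obtain ⟨⟨x, i, α⟩, a⟩ := q
        obtain rfl : i = 0 := Subsingleton.elim i 0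
        rfl }
  set H : Fin 3 → Matrix (TorusSite 4 L × Fin 1 × Fin 4) (TorusSite 4 L × Fin 1 × Fin 4) ℂ :=
    fun a => spinorLift gammaFive * wilsonDirac u1Rep (V a) m 1
  have hblock := flux_reindex_hermitianWilsonDirac_eq_blockDiagonal hU m e (fun _ => rfl)
  rw [← Matrix.charpoly_reindex e, hblock, flux_charpoly_blockDiagonal, Fin.prod_univ_three,
    Fin.sum_univ_three]
  have h0 : (H 0).charpoly.Monic := charpoly_monic _
  have h1 : (H 1).charpoly.Monic := charpoly_monic _
  have h2 : (H 2).charpoly.Monic := charpoly_monic _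
  have h01 : (H 0).charpoly * (H 1).charpoly ≠ 0 := (h0.mul h1).ne_zero
  have h012 : (H 0).charpoly * (H 1).charpoly * (H 2).charpoly ≠ 0 := ((h0.mul h1).mul h2).ne_zero
  change ((H 0).charpoly * (H 1).charpoly * (H 2).charpoly).roots.countP _ =
    (H 0).charpoly.roots.countP _ + (H 1).charpoly.roots.countP _ + (H 2).charpoly.roots.countP _
  rw [Polynomial.roots_mul h012, Polynomial.roots_mul h01, Multiset.countP_add, Multiset.countP_add]

/-- **Helper `flux_normAdmissible_of_diagonal` (S11).**  For a colour-diagonal `SU(3)` link field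
`U = diag (V 0, V 1, V 2)`, the plaquette matrix `U(p)` is the diagonal matrix of the three `U(1)`
plaquette phases `V a (p)`, so `1 − U(p) = diag (1 − V a (p))` has `ℓ²` operator norm
`max_a |1 − V a (p)|` (`Matrix.l2_opNorm_diagonal`); hence `U` is `ε`-norm-admissible as soon as
`|1 − V a (p)| ≤ ε` for all colours and all plaquettes. -/
theorem flux_normAdmissible_of_diagonal :
    ∀ (L : ℕ) [NeZero L] (U : GaugeConfig 4 L SU3) (V : Fin 3 → GaugeConfig 4 L Circle) (ε : ℝ),
      (∀ e : Edge 4 L, ((U e : SU3) : Matrix (Fin 3) (Fin 3) ℂ) = Matrix.diagonal fun a => ((V a e : Circle) : ℂ)) →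
      (∀ (a : Fin 3) (x : TorusSite 4 L) (μ ν : Fin 4),
        ‖(1 : ℂ) - ((plaquetteHolonomy (V a) x μ ν : Circle) : ℂ)‖ ≤ ε) →
      IsNormAdmissible (fundamentalRep (Fin 3)) U ε := by
  intro L _ U V ε hU hV p
  obtain ⟨x, ⟨⟨μ, ν⟩, _hμν⟩⟩ := p
  change ‖(1 : Matrix (Fin 3) (Fin 3) ℂ) - fundamentalRep (Fin 3) (plaquetteHolonomy U x μ ν)‖ ≤ ε
  have hε : 0 ≤ ε := (norm_nonneg _).trans (hV 0 x μ ν)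
  -- the inverse in `SU(3)` is the adjoint matrix (definitionally)
  have hinv : ∀ A : SU3, ((A⁻¹ : SU3) : Matrix (Fin 3) (Fin 3) ℂ) = star (A : Matrix (Fin 3) (Fin 3) ℂ) :=
    fun _ => rfl
  have hplaq : fundamentalRep (Fin 3) (plaquetteHolonomy U x μ ν) =
      diagonal fun a => ((plaquetteHolonomy (V a) x μ ν : Circle) : ℂ) := by
    rw [fundamentalRep_apply, plaquetteHolonomy, Submonoid.coe_mul, Submonoid.coe_mul,
      Submonoid.coe_mul, hinv, hinv, hU, hU, hU, hU, star_eq_conjTranspose,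
      star_eq_conjTranspose, diagonal_conjTranspose, diagonal_conjTranspose, diagonal_mul_diagonal,
      diagonal_mul_diagonal, diagonal_mul_diagonal]
    congr 1
    funext a
    simp only [Pi.star_apply, plaquetteHolonomy, Circle.coe_mul, Circle.coe_inv_eq_conj]
    rfl
  rw [hplaq, ← diagonal_one, diagonal_sub, l2_opNorm_diagonal, pi_norm_le_iff_of_nonneg hε]
  intro a
  exact hV a x μ ν

end Summit.QuantumFields.QCD.Cruxes.WindowExtinction.FreeVolumeHeavyWitness
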